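import Summits.HodgeConjecture.HodgeCM.Model.AdelicThetaTowerMap
import HarnessLib

/-!
# FLOOR-0 P4, stub T2′ (hol half), part 1/2 — cuspidal cotangent forms on the regime model and their COMPONENTS:
# the theta instance's `compAt` / `compClass` TRANSPORTED to general forms (part 2 = `Theorems/H413CuspCotTower.lean`: `towerFamily`, `clsAt`)

Cell hodgecm-mathlib (D-0151), FLOOR 0, crux item H413 = stmt-HodgeConjecture-24833; programme P4, line
`Cruxes/H413/Lines/P4AdmissibleOccursInH1.lean` v2.1, stub `stub_T2_matsushimaHodgeAt` («Matsushima–Hodge class map at the factor of record»).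
Author A-p13 (g21).  `--supports stmt-HodgeConjecture-24833`.

The HodgeCM theta lane built, for elements `F` of the slot's adèlic THETA module saturated at `sat(Γ.K)` with holomorphic germs along the
honest archimedean component `archInfOf V`, the component classes `compClass F h ∈ F¹H¹(P_{Γ.conj h})`, the family `towerFamily F ∈ H_K`
(binder-1's `towerLevel`), and the linear, `U(V)(𝔸_f)`-equivariant, level-independent tower class map `clsAt : holSat Γ →ₗ Tower … V`
(`Model/AdelicThetaComponents_{1,2}`, `AdelicThetaTowerClass`, `AdelicThetaTowerAction`, `AdelicThetaTowerMap`).  Reading those proofs, the ONLY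
properties of `F` used are: (L) left invariance under the rational points `(V.latticeModel _).Γ`; (R) right invariance under the saturation
subgroup `satLevelRegimeOf V hV Γ.K`; (W) weight `weightOf x₀` along `archInfOf V ∘ (Stab x₀ ↪ U(2,1))`; (H) `IsHolGerm (archInfOf V) F`.
This file DEFINES the space `cuspCotSat V hV K` of functions `G_U(𝔸) → ℂ²` with (L)(R)(W)(H) — the regime-model avatar of the P0 carrier
`holCotForms (archFactorOf F V)` at level `K` (`Theorems/H413CohFormsCarriers.lean`; the transport along `toLatticeModelG`, P0's
`toLatticeModelG_archFactorOf_ιinf` / `toLatticeModelG_finToAdelic`, is the next file) — and re-runs the template verbatim for it (THIS FILE = §1–§2; §3–§4 are part 2, `Theorems/H413CuspCotTower.lean`):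

* §1 `rightInvariants`, `cuspCotSat` (+ membership API, antitonicity in `K`, stability under `R_{e_g}` with `Γ ↦ Γ.conj g`);
* §2 components `comp V hV F h = (x ↦ F (archInfOf V x · finToG V hV h))`: weight (`comp_mul_κ₁`), left invariance under the level image of the
  conjugate level (`comp_levelImage_mul`, from `rat_split_level_archInfOf`), hence `comp_mem_weightForms` / `comp_mem_holWeightForms`, descent to a
  unique `(1,0)`-class `compClass` (`pinD … .descends`, `classMapDatumOf_pull_injective`), and the rational-translate identity
  `comp_rationalToFinAdelic_mul` (`exists_archInfOf_mul_mul_finToG_mem_Γ`);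
* §3 `towerFamily` ∈ `towerLevel Γ` (`towerFamily_mem`, binder-1's criterion `mem_towerLevel_of_translate_of_invariant`), `res_towerFamily`;
  behaviour under `R_{e_g}` (`= translate g`), under `Γ' ≤ Γ` (`= restrictLevel`), additivity;
* §4 `clsAt : cuspCotSat V hV Γ.K →ₗ[ℂ] Tower … V` with `of_smul_clsAt` (equivariance, `ℂ[U(V)(𝔸_f)]`-form), `of_smul_clsAt_of_mem`
  (`K`-fixed), `clsAt_of_le` (level independence), `res_clsAt`, and `clsAt_eq_zero_iff` (the class vanishes iff all components vanish —
  `TowerRes.ofLevel_injective` + injectivity of the level class maps).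

What remains for T2′ after this file: the transport `holCotForms (archFactorOf F V) ≃ ⋃_K cuspCotSat V hV K` (currency, P0 §3), the passage
from `clsAt` at SOME level to one map on the union (`clsAt_of_le` + directedness), injectivity on the P0 side (P0-lemmas file
`IsHonest.eq_zero_of_mem_cohForms` + `clsAt_eq_zero_iff`), the `(0,1)` half (complex conjugation on the tower), and `rhoB = act`
(`Representation.ofModule'` round trip) — see the T2-PLAN memo.  Universe records `hHD hI h₁ h₃ hA` are parameters, as in the template.
HC_CM is proved only modulo the 7 printed citations until rung 0 closes; this file proves nothing about them.
[cite: BorelWallach2000, VII 2.10, VII 3.2, VII 3.6; XIII 1.2] [cite: Borel1997, §5.14] [cite: BorelJacquet1979, §4.1–§4.2]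

## References
* [BorelWallach2000] A. Borel, N. Wallach, 2nd ed., VII 2.10/3.2/3.6 (Matsushima, Hodge bigrading), XIII 1.2 (adelic pieces).
* [Borel1997] A. Borel, *Automorphic forms on SL₂(ℝ)*, §5.14 (automorphy-factor dictionary).
* [BorelJacquet1979] A. Borel, H. Jacquet, Corvallis PSPM 33.1, §4.1–§4.2.
* Tree template: HodgeCM `Model/AdelicThetaComponents_1`, `_2`, `AdelicThetaTowerClass`, `AdelicThetaTowerAction`, `AdelicThetaTowerMap`
  (theta instance), `TowerLevel_*`, `TowerCarrier`, `TowerRes`, `LevelTranslate`, `ArchSideInstance`, `ArchSideLevel`, `AdelicThetaModuleFin_1`.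
-/

set_option autoImplicit false
set_option linter.dupNamespace false

noncomputable section

open MulAction NumberField
open Literature.NumberTheory.Automorphic Literature.NumberTheory.Weil1964
open Literature.NumberTheory.Automorphic.WeightForms (restrictHom thetaClasses IsLevelCorrected IsWeightMatched)
open Literature.Geometry.ComplexHyperbolic.BallModel (U21 x₀)
open Literature.AlgebraicGeometry.HodgeTheory Literature.AlgebraicGeometry.ShimuraVarieties
open Literature.NumberTheory.Automorphic.PicardCM
open Literature.NumberTheory.Transcendental (Arapura2012_Cor_15_4_6)
open HodgeCM HodgeCM.Model
open HodgeCM.Model.SupplyResidual HodgeCM.Model.ThetaSpace HodgeCM.Model.LevelTranslate HodgeCM.Model.TowerLevel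
open HodgeCM.Model.TowerCarrier

namespace Summit.HodgeConjecture.HodgeConjecture.Cruxes.H413.CuspCot

variable {L : CMField} {ι₁ : L →+* ℂ} (V : HermSpace3 L ι₁)

/-! ## §1 The space of saturated cuspidal cotangent forms on the regime model -/

/-- Functions on a group that are RIGHT-invariant under a subgroup `S`. [cite: BorelJacquet1979, §4.2] -/
def rightInvariants {G : Type} [Group G] (S : Subgroup G) : Submodule ℂ (G → (Fin 2 → ℂ)) where
  carrier := {F | ∀ k ∈ S, ∀ x, F (x * k) = F x}
  add_mem' := fun hF hF' k hk x => by simp only [Pi.add_apply, hF k hk x, hF' k hk x]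
  zero_mem' := fun _ _ _ => rfl
  smul_mem' := fun c F hF k hk x => by simp only [Pi.smul_apply, hF k hk x]

/-- **Saturated cuspidal cotangent forms of level `K` on the regime model group `G_U(𝔸) = (V.latticeModel _).G`**: `ℂ²`-valued functions
that are (L) left-invariant under the rational points, (W) of right `K_∞`-type `weightOf x₀` along `archInfOf V ∘ (Stab(x₀) ↪ U(2,1))`,
(R) right-invariant under the saturation subgroup `satLevelRegimeOf V hV K` (the away-from-`ι₁` archimedean factor times the level), and
(H) with holomorphic germs along `archInfOf V`.  (The regime-model avatar of P0's `holCotForms (archFactorOf F V)` at level `K`.)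
[cite: Borel1997, §5.14] [cite: BorelWallach2000, VII 2.10] [cite: BorelJacquet1979, §4.2] -/
def cuspCotSat (hV : IsAnisotropic L V.Hm) (K : Subgroup V.adelicFin) :
    Submodule ℂ ((V.latticeModel printFact_unitaryCompact_holds).G → (Fin 2 → ℂ)) :=
  weightForms (V.latticeModel printFact_unitaryCompact_holds).Γ ((archInfOf V).comp (stabilizer (↥U21) x₀).subtype)
      (BallForms.isPullbackCocycle_cotangentCocycle.weightOf x₀) ⊓
    rightInvariants (G := (V.latticeModel printFact_unitaryCompact_holds).G) (satLevelRegimeOf V hV K) ⊓ holGerms (archInfOf V)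

variable {V}
variable {hV : IsAnisotropic L V.Hm}

namespace cuspCotSat

/-- (L) left invariance under the rational points. [cite: BorelJacquet1979, §4.2] -/
theorem left_inv {K : Subgroup V.adelicFin} {F : (V.latticeModel printFact_unitaryCompact_holds).G → (Fin 2 → ℂ)}
    (hF : F ∈ cuspCotSat V hV K) {γ : (V.latticeModel printFact_unitaryCompact_holds).G}
    (hγ : γ ∈ (V.latticeModel printFact_unitaryCompact_holds).Γ) (x : (V.latticeModel printFact_unitaryCompact_holds).G) :
    F (γ * x) = F x :=
  hF.1.1.1 γ hγ x

/-- (W) the weight along `archInfOf V ∘ κ₁`. [cite: Borel1997, §5.14] -/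
theorem apply_mul_archInfOf {K : Subgroup V.adelicFin} {F : (V.latticeModel printFact_unitaryCompact_holds).G → (Fin 2 → ℂ)}
    (hF : F ∈ cuspCotSat V hV K) (u : ↥(stabilizer (↥U21) x₀)) (x : (V.latticeModel printFact_unitaryCompact_holds).G) :
    F (x * archInfOf V u) = (BallForms.isPullbackCocycle_cotangentCocycle.weightOf x₀) u⁻¹ (F x) :=
  hF.1.1.2 u x

/-- (R) right invariance under the saturation subgroup. [cite: BorelJacquet1979, §4.2] -/
theorem apply_mul_of_mem_sat {K : Subgroup V.adelicFin} {F : (V.latticeModel printFact_unitaryCompact_holds).G → (Fin 2 → ℂ)}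
    (hF : F ∈ cuspCotSat V hV K) {a : (V.latticeModel printFact_unitaryCompact_holds).G} (ha : a ∈ satLevelRegimeOf V hV K)
    (x : (V.latticeModel printFact_unitaryCompact_holds).G) : F (x * a) = F x :=
  hF.1.2 a ha x

/-- (H) holomorphic germs along `archInfOf V`. [cite: BorelWallach2000, VII 2.10] -/
theorem isHolGerm {K : Subgroup V.adelicFin} {F : (V.latticeModel printFact_unitaryCompact_holds).G → (Fin 2 → ℂ)}
    (hF : F ∈ cuspCotSat V hV K) : IsHolGerm (archInfOf V) F :=
  hF.2

/-- Constructor from the four clauses. [cite: BorelJacquet1979, §4.2] -/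
theorem mem_of {K : Subgroup V.adelicFin} {F : (V.latticeModel printFact_unitaryCompact_holds).G → (Fin 2 → ℂ)}
    (hL : ∀ γ ∈ (V.latticeModel printFact_unitaryCompact_holds).Γ, ∀ x, F (γ * x) = F x)
    (hW : ∀ (u : ↥(stabilizer (↥U21) x₀)) (x : (V.latticeModel printFact_unitaryCompact_holds).G),
      F (x * archInfOf V u) = (BallForms.isPullbackCocycle_cotangentCocycle.weightOf x₀) u⁻¹ (F x))
    (hR : ∀ a : (V.latticeModel printFact_unitaryCompact_holds).G, a ∈ satLevelRegimeOf V hV K → ∀ x, F (x * a) = F x)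
    (hH : IsHolGerm (archInfOf V) F) :
    F ∈ cuspCotSat V hV K :=
  ⟨⟨⟨hL, hW⟩, hR⟩, hH⟩

end cuspCotSat

/-- **Antitonicity in the level**: a form of level `K` is a form of every smaller level `K' ≤ K` (`satLevelRegimeOf_mono`).
[cite: BorelJacquet1979, §4.2] -/
theorem cuspCotSat_anti {K K' : Subgroup V.adelicFin} (hle : K' ≤ K) : cuspCotSat V hV K ≤ cuspCotSat V hV K' := fun _ hF =>
  cuspCotSat.mem_of hF.1.1.1 hF.1.1.2 (fun _ ha x => hF.1.2 _ (satLevelRegimeOf_mono V hV hle ha) x) hF.2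

/-- At levels: `Γ' ≤ Γ ⇒ cuspCotSat Γ.K ≤ cuspCotSat Γ'.K`. [cite: BorelJacquet1979, §4.2] -/
theorem cuspCotSat_anti_level {Γ Γ' : Level V} (hle : Γ' ≤ Γ) : cuspCotSat V hV Γ.K ≤ cuspCotSat V hV Γ'.K :=
  cuspCotSat_anti (Level.le_def.mp hle)

/-- **Right translation by `e_g = finToG V hV g` maps level `Γ.K` to level `(Γ.conj g).K = gKg⁻¹`.** [cite: BorelJacquet1979, §4.2] -/
theorem rightShift_mem_cuspCotSat_conj {Γ : Level V} (hΓ : Γ.BelowConjThree)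
    {F : (V.latticeModel printFact_unitaryCompact_holds).G → (Fin 2 → ℂ)} (hF : F ∈ cuspCotSat V hV Γ.K) (g : V.adelicFin) :
    rightShift (finToG V hV g) F ∈ cuspCotSat V hV (Γ.conj g hΓ).K := by
  refine cuspCotSat.mem_of (fun γ hγ x => ?_) (fun u x => ?_) (fun a ha x => ?_) ?_
  · show F (γ * x * finToG V hV g) = F (x * finToG V hV g)
    rw [mul_assoc]; exact cuspCotSat.left_inv hF hγ _
  · show F (x * archInfOf V u * finToG V hV g) = _
    rw [mul_assoc, ← (commute_finToG_archInfOf V hV g u).eq, ← mul_assoc]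
    exact cuspCotSat.apply_mul_archInfOf hF u _
  · show F (x * a * finToG V hV g) = F (x * finToG V hV g)
    have ha' := finToG_inv_mul_mul_mem_satLevelRegimeOf V hV hΓ g ha
    have e : x * a * finToG V hV g = x * finToG V hV g * ((finToG V hV g)⁻¹ * a * finToG V hV g) := by group
    rw [e]; exact cuspCotSat.apply_mul_of_mem_sat hF ha' _
  · exact (cuspCotSat.isHolGerm hF).comp_mul_right (commute_finToG_archInfOf V hV g)

/-! ## §2 Components: holomorphic weight forms of the conjugate levels and their `(1,0)`-classes -/

variable (V hV) in
/-- **The component of index `h ∈ U(V)(𝔸_f)`** of `F`, read on `U(2,1)` through `archInfOf V`: `x ↦ F (archInfOf V x · finToG V hV h)`.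
[cite: BorelWallach2000, XIII 1.2] -/
def comp (F : (V.latticeModel printFact_unitaryCompact_holds).G → (Fin 2 → ℂ)) (h : V.adelicFin) : ↥U21 → (Fin 2 → ℂ) :=
  fun x => F (archInfOf V x * finToG V hV h)

/-- Unfolding `comp`. [cite: BorelWallach2000, XIII 1.2] -/
@[simp] theorem comp_apply (F : (V.latticeModel printFact_unitaryCompact_holds).G → (Fin 2 → ℂ)) (h : V.adelicFin) (x : ↥U21) :
    comp V hV F h x = F (archInfOf V x * finToG V hV h) := rfl

/-- **Re-indexing is right translation**: `comp (R_{e_g} F) h = comp F (h g)`. [cite: BorelWallach2000, XIII 1.2] -/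
theorem comp_rightShift (F : (V.latticeModel printFact_unitaryCompact_holds).G → (Fin 2 → ℂ)) (g h : V.adelicFin) :
    comp V hV (rightShift (finToG V hV g) F) h = comp V hV F (h * g) := by
  funext x
  show F (archInfOf V x * finToG V hV h * finToG V hV g) = F (archInfOf V x * finToG V hV (h * g))
  rw [map_mul, mul_assoc]

/-- **Weight of the components**: `comp F h (x · u) = weightOf x₀ u⁻¹ (comp F h x)` for `u ∈ Stab(x₀)`. [cite: Borel1997, §5.14] -/
theorem comp_mul_κ₁ {K : Subgroup V.adelicFin} {F : (V.latticeModel printFact_unitaryCompact_holds).G → (Fin 2 → ℂ)}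
    (hF : F ∈ cuspCotSat V hV K) (h : V.adelicFin) (x : ↥U21) (u : ↥(stabilizer (↥U21) x₀)) :
    comp V hV F h (x * u) = (BallForms.isPullbackCocycle_cotangentCocycle.weightOf x₀) u⁻¹ (comp V hV F h x) := by
  show F (archInfOf V (x * u) * finToG V hV h) = _
  rw [map_mul, mul_assoc, ← (commute_finToG_archInfOf V hV h u).eq, ← mul_assoc]
  exact cuspCotSat.apply_mul_archInfOf hF u _

section Pin

variable (hHD : exists_isReal_hodgeModel) (hI : hodgePQ_independent_of_hodgeModel)
  (h₁ : BallQuotientUniformised) (h₃ : CMAbelianVarietyRealised) (hA : Arapura2012_Cor_15_4_6)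

/-- **(L3) at the honest archimedean component**: every `δ` in the level image of `Γ` has a corrector in `sat(Γ.K)` into the rational
points commuting with `archInfOf V` (`exists_toBall_eq_of_mem_levelImage` + `rat_split_level_archInfOf`). [cite: BorelJacquet1979, §4.1] -/
theorem exists_corrector_of_mem_levelImage (Γ : Level V) (hV : IsAnisotropic L V.Hm) {δ : ↥U21}
    (hδ : δ ∈ levelImage hHD hI h₁ h₃ Γ hV) :
    ∃ a : (V.latticeModel printFact_unitaryCompact_holds).G, a ∈ satLevelRegimeOf V hV Γ.K ∧
      archInfOf V δ * a ∈ (V.latticeModel printFact_unitaryCompact_holds).Γ ∧ ∀ y : ↥U21, Commute a (archInfOf V y) := by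
  obtain ⟨g, hg, rfl⟩ := exists_toBall_eq_of_mem_levelImage hHD hI h₁ h₃ Γ hV hδ
  exact rat_split_level_archInfOf V hV Γ.K g hg

/-- **Left invariance of the components under the level image of the conjugate level** `(U(V)(L⁺) ∩ hKh⁻¹, hKh⁻¹)`.
[cite: BorelWallach2000, XIII 1.2] -/
theorem comp_levelImage_mul {Γ : Level V} (hΓ : Γ.BelowConjThree)
    {F : (V.latticeModel printFact_unitaryCompact_holds).G → (Fin 2 → ℂ)} (hF : F ∈ cuspCotSat V hV Γ.K) (h : V.adelicFin)
    {δ : ↥U21} (hδ : δ ∈ levelImage hHD hI h₁ h₃ (Γ.conj h hΓ) hV) (x : ↥U21) :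
    comp V hV F h (δ * x) = comp V hV F h x := by
  obtain ⟨a, ha, haΓ, hcomm⟩ := exists_corrector_of_mem_levelImage hHD hI h₁ h₃ (Γ.conj h hΓ) hV hδ
  have ha' : a⁻¹ ∈ satLevelRegimeOf V hV (Γ.conj h hΓ).K := inv_mem ha
  have hsat' : (finToG V hV h)⁻¹ * a⁻¹ * finToG V hV h ∈ satLevelRegimeOf V hV Γ.K :=
    finToG_inv_mul_mul_mem_satLevelRegimeOf V hV hΓ h ha'
  calc comp V hV F h (δ * x)
      = F ((archInfOf V δ * a) * (a⁻¹ * (archInfOf V x * finToG V hV h))) := by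
          show F (archInfOf V (δ * x) * finToG V hV h) = _
          rw [map_mul]; congr 1; group
    _ = F (a⁻¹ * (archInfOf V x * finToG V hV h)) := cuspCotSat.left_inv hF haΓ _
    _ = F (archInfOf V x * finToG V hV h * ((finToG V hV h)⁻¹ * a⁻¹ * finToG V hV h)) := by
          rw [← mul_assoc, (hcomm x).inv_left.eq]; congr 1; group
    _ = F (archInfOf V x * finToG V hV h) := cuspCotSat.apply_mul_of_mem_sat hF hsat' _

/-- **The components are weight forms of the conjugate levels.** [cite: Borel1997, §5.14] -/
theorem comp_mem_weightForms {Γ : Level V} (hΓ : Γ.BelowConjThree)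
    {F : (V.latticeModel printFact_unitaryCompact_holds).G → (Fin 2 → ℂ)} (hF : F ∈ cuspCotSat V hV Γ.K) (h : V.adelicFin) :
    comp V hV F h ∈ weightForms (levelImage hHD hI h₁ h₃ (Γ.conj h hΓ) hV) (stabilizer (↥U21) x₀).subtype
      (BallForms.isPullbackCocycle_cotangentCocycle.weightOf x₀) :=
  ⟨fun _ hδ x => comp_levelImage_mul hHD hI h₁ h₃ hΓ hF h hδ x, fun u x => comp_mul_κ₁ hF h x u⟩

/-- **… and holomorphic** (the germ of `comp F h` at `g` is the germ of `F` at `archInfOf V g · e_h`). [cite: BorelWallach2000, VII 2.10] -/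
theorem comp_mem_holWeightForms {Γ : Level V} (hΓ : Γ.BelowConjThree)
    {F : (V.latticeModel printFact_unitaryCompact_holds).G → (Fin 2 → ℂ)} (hF : F ∈ cuspCotSat V hV Γ.K) (h : V.adelicFin) :
    (⟨comp V hV F h, comp_mem_weightForms hHD hI h₁ h₃ hΓ hF h⟩ :
        weightForms (levelImage hHD hI h₁ h₃ (Γ.conj h hΓ) hV) (stabilizer (↥U21) x₀).subtype
          (BallForms.isPullbackCocycle_cotangentCocycle.weightOf x₀)) ∈
      BallForms.holWeightForms (levelImage hHD hI h₁ h₃ (Γ.conj h hΓ) hV) BallForms.isPullbackCocycle_cotangentCocycle := by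
  have hhol := cuspCotSat.isHolGerm hF
  have e : ∀ g : ↥U21, (fun b : Fin 2 → ℂ => comp V hV F h (g * BallForms.expP b)) =
      germAt (archInfOf V) F (archInfOf V g * finToG V hV h) := by
    intro g; funext b
    show F (archInfOf V (g * BallForms.expP b) * finToG V hV h) = F (archInfOf V g * finToG V hV h * archInfOf V (BallForms.expP b))
    rw [map_mul, mul_assoc, ← (commute_finToG_archInfOf V hV h (BallForms.expP b)).eq, ← mul_assoc]
  refine BallForms.mem_holWeightForms_of_differentiableAt _ (fun g => ?_) (fun g v => ?_)
  · show DifferentiableAt ℝ (fun b : Fin 2 → ℂ => comp V hV F h (g * BallForms.expP b)) 0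
    rw [e g]; exact hhol.1 _
  · show fderiv ℝ (fun b : Fin 2 → ℂ => comp V hV F h (g * BallForms.expP b)) 0 (Complex.I • v) =
      Complex.I • fderiv ℝ (fun b : Fin 2 → ℂ => comp V hV F h (g * BallForms.expP b)) 0 v
    rw [e g]; exact hhol.2 _ v

/-- **The component of index `h` is `pull` of a UNIQUE `(1,0)`-class of `P_{Γ.conj h}`.** [cite: BorelWallach2000, VII 3.2] -/
theorem exists_unique_pull_eq_comp {Γ : Level V} (hΓ : Γ.BelowConjThree)
    {F : (V.latticeModel printFact_unitaryCompact_holds).G → (Fin 2 → ℂ)} (hF : F ∈ cuspCotSat V hV Γ.K) (h : V.adelicFin) :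
    ∃! cl : (pinD hHD hI h₁ h₃ (Γ.conj h hΓ) hV).H10, ((pinD hHD hI h₁ h₃ (Γ.conj h hΓ) hV).pull cl).1 = comp V hV F h := by
  obtain ⟨cl, hcl⟩ := (pinD hHD hI h₁ h₃ (Γ.conj h hΓ) hV).descends _ (comp_mem_holWeightForms hHD hI h₁ h₃ hΓ hF h)
  have hinj : Function.Injective (pinD hHD hI h₁ h₃ (Γ.conj h hΓ) hV).pull :=
    classMapDatumOf_pull_injective hHD hI h₁ h₃ (Γ.conj h hΓ) hV _ (MonoidHom.id (↥U21)) _ _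
  refine ⟨cl, congrArg Subtype.val hcl, fun cl' hcl' => hinj ?_⟩
  rw [hcl]
  exact Subtype.ext hcl'

/-- **The component class** `compClass F h ∈ F¹H¹(P_{Γ.conj h})`. [cite: BorelWallach2000, VII 3.2] -/
def compClass {Γ : Level V} (hΓ : Γ.BelowConjThree)
    {F : (V.latticeModel printFact_unitaryCompact_holds).G → (Fin 2 → ℂ)} (hF : F ∈ cuspCotSat V hV Γ.K) (h : V.adelicFin) :
    (pinD hHD hI h₁ h₃ (Γ.conj h hΓ) hV).H10 :=
  (exists_unique_pull_eq_comp hHD hI h₁ h₃ hΓ hF h).choose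

/-- Defining property: `pull (compClass F h) = comp F h`. [cite: BorelWallach2000, VII 3.2] -/
theorem pull_compClass {Γ : Level V} (hΓ : Γ.BelowConjThree)
    {F : (V.latticeModel printFact_unitaryCompact_holds).G → (Fin 2 → ℂ)} (hF : F ∈ cuspCotSat V hV Γ.K) (h : V.adelicFin) :
    ((pinD hHD hI h₁ h₃ (Γ.conj h hΓ) hV).pull (compClass hHD hI h₁ h₃ hΓ hF h)).1 = comp V hV F h :=
  (exists_unique_pull_eq_comp hHD hI h₁ h₃ hΓ hF h).choose_spec.1

/-- **The components at related indices differ by a left translate**, abstract splitting data. [cite: BorelWallach2000, XIII 1.2] -/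
theorem comp_mul_of_split {Γ : Level V} {F : (V.latticeModel printFact_unitaryCompact_holds).G → (Fin 2 → ℂ)}
    (hF : F ∈ cuspCotSat V hV Γ.K) {γt : ↥U21} {γf : V.adelicFin} {a : (V.latticeModel printFact_unitaryCompact_holds).G}
    (ha : a ∈ satLevelRegimeOf V hV Γ.K) (hcι : ∀ y : ↥U21, Commute a (archInfOf V y))
    (hce : ∀ kf : V.adelicFin, Commute a (finToG V hV kf))
    (hmem : archInfOf V γt * a * finToG V hV γf ∈ (V.latticeModel printFact_unitaryCompact_holds).Γ)
    (h : V.adelicFin) {kK : V.adelicFin} (hk : kK ∈ Γ.K) (x : ↥U21) :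
    comp V hV F (γf * h * kK) (γt * x) = comp V hV F h x := by
  have hcx : Commute (finToG V hV γf) (archInfOf V x) := commute_finToG_archInfOf V hV γf x
  have hca : Commute a (finToG V hV γf) := hce γf
  have hcax : Commute a (archInfOf V x * finToG V hV h) := (hcι x).mul_right (hce h)
  have hsat : a⁻¹ * finToG V hV kK ∈ satLevelRegimeOf V hV Γ.K :=
    Subgroup.mul_mem _ (Subgroup.inv_mem _ ha) (finToG_mem_satLevelRegimeOf V hV hk)
  have e1 : archInfOf V γt * archInfOf V x * (finToG V hV γf * finToG V hV h * finToG V hV kK) =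
      (archInfOf V γt * a * finToG V hV γf) * (a⁻¹ * (archInfOf V x * finToG V hV h) * finToG V hV kK) := by
    calc archInfOf V γt * archInfOf V x * (finToG V hV γf * finToG V hV h * finToG V hV kK)
        = archInfOf V γt * (archInfOf V x * finToG V hV γf) * finToG V hV h * finToG V hV kK := by group
      _ = archInfOf V γt * (finToG V hV γf * archInfOf V x) * finToG V hV h * finToG V hV kK := by rw [hcx.eq]
      _ = archInfOf V γt * (a * a⁻¹ * finToG V hV γf) * archInfOf V x * finToG V hV h * finToG V hV kK := by group
      _ = archInfOf V γt * (a * (finToG V hV γf * a⁻¹)) * archInfOf V x * finToG V hV h * finToG V hV kK := by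
            rw [mul_assoc a, hca.inv_left.eq]
      _ = (archInfOf V γt * a * finToG V hV γf) * (a⁻¹ * (archInfOf V x * finToG V hV h) * finToG V hV kK) := by group
  have e2 : a⁻¹ * (archInfOf V x * finToG V hV h) * finToG V hV kK = archInfOf V x * finToG V hV h * (a⁻¹ * finToG V hV kK) := by
    rw [hcax.inv_left.eq]; group
  calc comp V hV F (γf * h * kK) (γt * x)
      = F (archInfOf V γt * archInfOf V x * (finToG V hV γf * finToG V hV h * finToG V hV kK)) := by
          show F (archInfOf V (γt * x) * finToG V hV (γf * h * kK)) = _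
          rw [map_mul, map_mul, map_mul]
    _ = F ((archInfOf V γt * a * finToG V hV γf) * (a⁻¹ * (archInfOf V x * finToG V hV h) * finToG V hV kK)) := by rw [e1]
    _ = F (a⁻¹ * (archInfOf V x * finToG V hV h) * finToG V hV kK) := cuspCotSat.left_inv hF hmem _
    _ = F (archInfOf V x * finToG V hV h * (a⁻¹ * finToG V hV kK)) := by rw [e2]
    _ = F (archInfOf V x * finToG V hV h) := cuspCotSat.apply_mul_of_mem_sat hF hsat _
    _ = comp V hV F h x := rfl

/-- **The components at related indices differ by the rational translate**: `comp F ((γ)_f h k) (γ̃ x) = comp F h x`, `γ̃ = toBall γ`,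
`k ∈ Γ.K` (binder-1's relation `Rel Γ γ h h'`). [cite: BorelWallach2000, XIII 1.2] -/
theorem comp_rationalToFinAdelic_mul {Γ : Level V} {F : (V.latticeModel printFact_unitaryCompact_holds).G → (Fin 2 → ℂ)}
    (hF : F ∈ cuspCotSat V hV Γ.K) (g : ↥(unitaryGroup (IsCMField.complexConj L : L →+* L) V.Hm)) (h : V.adelicFin)
    {kK : V.adelicFin} (hk : kK ∈ Γ.K) (x : ↥U21) :
    comp V hV F
        (UnitaryGroup.rationalToFinAdelic (↥(maximalRealSubfield L)) (L : Type) (IsCMField.complexConj L) 3 V.Hm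
            (UnitaryGroup.ballRational (L : Type) V.Hm g) * h * kK)
        (BallRational.toBall L ι₁ V.Hm V.sylvesterFrame (sylvesterFrame_J V) g * x) =
      comp V hV F h x := by
  obtain ⟨a, hasat, hcι, hce, hmem⟩ := exists_archInfOf_mul_mul_finToG_mem_Γ V hV g
  exact comp_mul_of_split hF (hasat Γ.K) hcι hce hmem h hk x

end Pin

end Summit.HodgeConjecture.HodgeConjecture.Cruxes.H413.CuspCot

end
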